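import Literature.Probability.LatticeModels.GreenFunctionConformalRadius
import Literature.Probability.LatticeModels.DirichletGreenFunction
import Literature.Probability.LatticeModels.LatticePotentialKernel
import HarnessLib

/-!
# Kozdron–Lawler 2005, Theorem 1.2 — proved steps of the printed proof (discrete side)

Topic `Literature/Probability/LatticeModels`; sibling of `GreenFunctionConformalRadius.lean`, which
STATES Kozdron–Lawler's Theorem 1.2 (`greenFunction_origin_eq_log_conformalRadius`:
`G_A(0) = -(2/π) log f_A'(0) + k₀ + O(n^{-1/3} log n)` uniformly over `A ∈ 𝒜ⁿ`) as a named fact.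
This file collects, fully proved and in the tree's vocabulary, the steps of the printed proof
(M. J. Kozdron, G. F. Lawler, Electron. J. Probab. 10 (2005), §2.3 and §3.2) that the tree can
presently carry; the theorem itself is NOT proved here (see "What is missing" below), and no named
fact is introduced.

## What is proved

* `KozdronLawler.killedGreen_siteGraph_eq_four_mul_dirichletGreen` — **the path-space Green function
  of the walk killed on leaving a finite `A ⊆ ℤ²` is the matrix Green function**:
  `SRW.killedGreen (siteGraph A) x y = 4 · dirichletGreen A x y` (`y ∈ A`), i.e.
  `Σₙ Pˣ[S₀,…,Sₙ ∈ A, Sₙ = y] = ((I - P_A)⁻¹)_{xy} = 4 (M_A⁻¹)_{xy}` with `M_A = 4·1 - A_A` the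
  Dirichlet Laplacian matrix of `DirichletGreenFunction.lean` (Lawler 1991, §1.5; Kozdron–Lawler
  2005, eq. (14)).  Proof: `x ↦ G(x, y)` solves `M_A u = 4 δ_y` by the first-step equation
  `SRW.killedGreen_first_step_of_finite_support`, and `M_A` is invertible
  (`isUnit_det_dirichletMatrix`).
* `KozdronLawler.killedGreen_origin_eq_sum_poissonKernel_mul_potentialKernel` — **eq. (15) of
  Kozdron–Lawler at the origin**, "`G_A(0) = E⁰[a(S_{τ_A})]`" (Lawler 1991, Prop. 1.6.3), in the
  form `SRW.killedGreen (siteGraph A) 0 0 = 2 Σ_{z ∈ ∂A} H_A(0, z) a(z)` with the tree's Poisson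
  kernel `poissonKernel A 0 z` (exit distribution of the walk from `0`) and the tree's potential
  kernel `a = latticePotentialKernel 2` (normalised by `Δ a = 2δ₀`, i.e. HALF of Kozdron–Lawler's
  `a`, whence the factor `2`).  Proof: Green's representation formula
  (`green_representation`) for `F = a` at `x = 0`, with `a(0) = 0` and `-Δ a = -2δ₀`.
* `KozdronLawler.sum_poissonKernel_eq_one`, `KozdronLawler.norm_ge_of_mem_outerBoundary` — the
  bookkeeping facts used when (15) is combined with the asymptotics of `a`: the exit distribution
  has total mass `1`, and every exit point `z ∈ ∂A` of `A ∈ 𝒜ⁿ` has `|z| ≥ n`.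

## What is missing for `greenFunction_origin_eq_log_conformalRadius_holds` (recorded, not claimed)

Following §3.2 of the paper: (16) the expansion `a(x) = (2/π) log|x| + k₀ + O(|x|^{-3/2})` of the
planar potential kernel with the constant `k₀ = (2ς + 3 log 2)/π` (Lawler–Limic 2010, Thm. 4.4.4);
(11)+(17) `E⁰[log |B_{T_Ã}|] = -log f_A'(0)` for planar Brownian motion; and Lemma 3.4,
`|Eˣ log|B_{T_A}| - Eˣ log|S_{τ_A}|| ≤ c n^{-1/3} log n`, whose proof uses the Komlós–Major–Tusnády
strong approximation (Thm. 3.1) and the SHARP (exponent `1/2`) Beurling estimates, discrete and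
continuous (Cor. 2.8, 2.9) — none of the last three inputs is in the tree at the time of writing
(the tree has the weak Beurling estimate `WeakBeurlingEstimate.lean` and the Skorokhod coupling
`SkorokhodSRWStrongApprox.lean`, whose exponents do not reach `n^{-1/3} log n`).

## References

* M. J. Kozdron, G. F. Lawler, *Estimates of random walk exit probabilities and application to
  loop-erased random walk*, Electron. J. Probab. 10 (2005) 1442–1467, §2.3 eq. (14)–(16), §3.2
  [KozdronLawler2005].
* G. F. Lawler, *Intersections of Random Walks* (1991), §1.5–1.6, Prop. 1.6.3 [Lawler1991].
-/

noncomputable section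

open Finset Matrix
open Literature.Probability.RandomPlanarGeometry (ChordalLERW.siteGraph ChordalLERW.siteGraph_adj_iff)

namespace Literature.Probability.LatticeModels

namespace KozdronLawler

variable {d : ℕ}

/-! ### Sums over the `2d` directions -/

/-- A sum over the `2d` unit steps from `x` is the sum over the lattice neighbours of `x`.
[folklore] -/
theorem sum_dir_eq_sum_neighborFinset (g : Site d → ℝ) (x : Site d) :
    ∑ e : SRW.Dir d, g (x + SRW.stepVec e) = ∑ y ∈ (zdGraph d).neighborFinset x, g y := by
  classical
  have hf : Function.Injective fun e : SRW.Dir d => x + SRW.stepVec e :=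
    fun p q h => SRW.stepVec_injective (add_left_cancel h)
  have himage : (zdGraph d).neighborFinset x =
      (univ : Finset (SRW.Dir d)).image fun e => x + SRW.stepVec e := by
    rw [neighborFinset_zdGraph_eq_image]
    refine Finset.image_congr fun e _ => ?_
    unfold SRW.stepVec
    cases e.2 <;> simp [Pi.single_neg]
  rw [himage, Finset.sum_image fun p _ q _ h => hf h]

/-! ### The killed Green function of `siteGraph A` is `4 · dirichletGreen A` -/

section PlanarSet

variable (A : Finset (Site 2))

/-- The non-isolated vertices of `siteGraph A` lie in `A`. [folklore] -/
theorem support_siteGraph_subset : (ChordalLERW.siteGraph (↑A : Set (Site 2))).support ⊆ ↑A := by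
  intro x hx
  obtain ⟨y, hy⟩ := (SimpleGraph.mem_support _).1 hx
  exact (ChordalLERW.siteGraph_adj_iff.1 hy).2.1

/-- `siteGraph A` has finitely many non-isolated vertices (so the killed Green function converges
and satisfies the first-step equation, `SRW.killedGreen_first_step_of_finite_support`). [folklore] -/
theorem finite_support_siteGraph : (ChordalLERW.siteGraph (↑A : Set (Site 2))).support.Finite :=
  A.finite_toSet.subset (support_siteGraph_subset A)

/-- The first-step equation of the killed Green function of `siteGraph A`, with the adjacency
indicator resolved: for `x ∈ A`,
`G(x, y) = [x = y] + ¼ Σ_{w ∼ x} Ḡ(w, y)` where `Ḡ(w, y) = G(w, y)` for `w ∈ A` and `0` otherwise.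
[folklore] -/
theorem killedGreen_siteGraph_first_step {x : Site 2} (hx : x ∈ A) (y : Site 2) :
    SRW.killedGreen (ChordalLERW.siteGraph (↑A : Set (Site 2))) x y =
      (if x = y then 1 else 0) + (4 : ℝ)⁻¹ * ∑ w ∈ (zdGraph 2).neighborFinset x,
        (if w ∈ A then SRW.killedGreen (ChordalLERW.siteGraph (↑A : Set (Site 2))) w y else 0) := by
  classical
  rw [SRW.killedGreen_first_step_of_finite_support (finite_support_siteGraph A) x y]
  have h4 : (2 * (2 : ℕ) : ℝ)⁻¹ = (4 : ℝ)⁻¹ := by norm_num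
  rw [h4, ← sum_dir_eq_sum_neighborFinset
    (fun w => if w ∈ A then SRW.killedGreen (ChordalLERW.siteGraph (↑A : Set (Site 2))) w y else 0) x]
  congr 2
  refine Finset.sum_congr rfl fun e _ => ?_
  have hiff : (ChordalLERW.siteGraph (↑A : Set (Site 2))).Adj x (x + SRW.stepVec e) ↔
      x + SRW.stepVec e ∈ A := by
    rw [ChordalLERW.siteGraph_adj_iff]
    exact ⟨fun h => h.2.2, fun h => ⟨SRW.adj_add_stepVec x e, hx, h⟩⟩
  by_cases hmem : x + SRW.stepVec e ∈ A
  · rw [if_pos (hiff.2 hmem), if_pos hmem]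
  · rw [if_neg (fun h => hmem (hiff.1 h)), if_neg hmem]

/-- Off `A` the killed Green function of `siteGraph A` towards a point of `A` vanishes (the walk
is killed at once). [folklore] -/
theorem killedGreen_siteGraph_of_not_mem {x : Site 2} (hx : x ∉ A) {y : Site 2} (hy : y ∈ A) :
    SRW.killedGreen (ChordalLERW.siteGraph (↑A : Set (Site 2))) x y = 0 := by
  classical
  have hxy : x ≠ y := fun h => hx (h ▸ hy)
  rw [SRW.killedGreen_first_step_of_finite_support (finite_support_siteGraph A) x y, if_neg hxy,
    Finset.sum_eq_zero (fun e _ => if_neg (fun h => hx (ChordalLERW.siteGraph_adj_iff.1 h).2.1)),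
    mul_zero, add_zero]

/-- **The killed Green function solves the Dirichlet system**: the restriction to `A` of
`x ↦ G(x, y)` satisfies `M_A u = 4 δ_y` (for `y ∉ A` the right-hand side vanishes on `A`).
[folklore] -/
theorem dirichletMatrix_mulVec_killedGreen (y : Site 2) :
    dirichletMatrix A *ᵥ (fun x : A => SRW.killedGreen (ChordalLERW.siteGraph (↑A : Set (Site 2))) x y) =
      fun x : A => if (x : Site 2) = y then 4 else 0 := by
  classical
  set Gr := ChordalLERW.siteGraph (↑A : Set (Site 2)) with hGr
  funext x
  rw [mulVec_dirichletMatrix, latticeLaplacianZd_eq_sum_neighborFinset, Finset.sum_sub_distrib,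
    Finset.sum_const, card_neighborFinset_zdGraph_holds, nsmul_eq_mul, zeroExtend_coe]
  -- the zero extension of `u` is `w ↦ [w ∈ A] G(w, y)`
  have hext : ∀ w, zeroExtend A (fun x : A => SRW.killedGreen Gr x y) w =
      if w ∈ A then SRW.killedGreen Gr w y else 0 := by
    intro w
    by_cases hw : w ∈ A
    · rw [zeroExtend_of_mem _ hw, if_pos hw]
    · rw [zeroExtend_of_not_mem _ hw, if_neg hw]
  simp_rw [hext]
  have hfs := killedGreen_siteGraph_first_step A x.2 y
  rw [hGr] at *
  push_cast
  rw [hfs]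
  split_ifs <;> ring

/-- **The path-space Green function of the walk killed on leaving a finite `A ⊆ ℤ²` is the matrix
Green function** `4 (M_A⁻¹)_{xy}`: for `y ∈ A` and every `x`,
`SRW.killedGreen (siteGraph A) x y = 4 · dirichletGreen A x y`
(`Σₙ Pˣ[S₀, …, Sₙ ∈ A, Sₙ = y] = ((I - P_A)⁻¹)_{xy}`; Lawler 1991, §1.5; Kozdron–Lawler 2005,
eq. (14)). [cite: KozdronLawler2005, §2.3 eq. (14)] -/
theorem killedGreen_siteGraph_eq_four_mul_dirichletGreen {y : Site 2} (hy : y ∈ A) (x : Site 2) :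
    SRW.killedGreen (ChordalLERW.siteGraph (↑A : Set (Site 2))) x y = 4 * dirichletGreen A x y := by
  classical
  by_cases hx : x ∈ A
  · set u : A → ℝ := fun x : A => SRW.killedGreen (ChordalLERW.siteGraph (↑A : Set (Site 2))) x y
      with hu
    have hdet := isUnit_det_dirichletMatrix (by norm_num : 0 < 2) A
    have hsolve : u = (dirichletMatrix A)⁻¹ *ᵥ fun x : A => if (x : Site 2) = y then 4 else 0 := by
      rw [← dirichletMatrix_mulVec_killedGreen A y, mulVec_mulVec, nonsing_inv_mul _ hdet, one_mulVec]
    have hux : u ⟨x, hx⟩ = 4 * (dirichletMatrix A)⁻¹ ⟨x, hx⟩ ⟨y, hy⟩ := by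
      rw [hsolve, mulVec, dotProduct]
      have : ∀ z : A, (dirichletMatrix A)⁻¹ ⟨x, hx⟩ z * (if (z : Site 2) = y then 4 else 0) =
          if z = ⟨y, hy⟩ then 4 * (dirichletMatrix A)⁻¹ ⟨x, hx⟩ ⟨y, hy⟩ else 0 := by
        intro z
        by_cases hz : z = ⟨y, hy⟩
        · subst hz; simp [mul_comm]
        · have hz' : (z : Site 2) ≠ y := fun h => hz (Subtype.ext h)
          rw [if_neg hz', if_neg hz, mul_zero]
      rw [Finset.sum_congr rfl fun z _ => this z, Finset.sum_ite_eq' Finset.univ, if_pos (Finset.mem_univ _)]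
    rw [dirichletGreen_of_mem hx hy, ← hux]
  · rw [killedGreen_siteGraph_of_not_mem A hx hy, dirichletGreen_of_not_mem_left A hx, mul_zero]

/-! ### Eq. (15) at the origin: `G_A(0) = E⁰[a(S_{τ_A})]` -/

/-- **Kozdron–Lawler (15) at the origin** ("`G_A(x) = Eˣ[a(S_{τ_A})] - a(x)`" with `x = 0`,
`a(0) = 0`; Lawler 1991, Prop. 1.6.3): for a finite `A ∋ 0`,
`G_A(0, 0) = 2 Σ_{z ∈ ∂A} H_A(0, z) a(z)`, where `H_A(0, ·) = poissonKernel A 0` is the exit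
distribution of the walk from `0` and `a = latticePotentialKernel 2` is the tree's potential
kernel (`Δ a = 2δ₀`, half of the paper's `a`, whence the `2`). [cite: KozdronLawler2005, §2.3 eq. (15)] -/
theorem killedGreen_origin_eq_sum_poissonKernel_mul_potentialKernel (h0 : (0 : Site 2) ∈ A) :
    SRW.killedGreen (ChordalLERW.siteGraph (↑A : Set (Site 2))) 0 0 =
      2 * ∑ z ∈ outerBoundary (zdGraph 2) A, poissonKernel A 0 z * latticePotentialKernel 2 z := by
  classical
  have hrep := green_representation (by norm_num : 0 < 2) A (latticePotentialKernel 2) h0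
  rw [latticePotentialKernel_zero] at hrep
  have hlap : ∀ y, dirichletGreen A 0 y * -latticeLaplacianZd (latticePotentialKernel 2) y =
      if (0 : Site 2) = y then -(2 * dirichletGreen A 0 0) else 0 := by
    intro y
    rw [latticeLaplacianZd_latticePotentialKernel 2 (by norm_num) y]
    by_cases hy : (0 : Site 2) = y
    · subst hy; simp; ring
    · have hy' : y ≠ 0 := fun h => hy h.symm
      rw [if_neg hy', if_neg hy]; ring
  simp_rw [hlap] at hrep
  rw [Finset.sum_ite_eq, if_pos h0] at hrep
  rw [killedGreen_siteGraph_eq_four_mul_dirichletGreen A h0 0]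
  linarith

/-- The exit distribution from a point of `A` has total mass one (re-export of
`sum_poissonKernel` in dimension `2`). [folklore] -/
theorem sum_poissonKernel_eq_one {x : Site 2} (hx : x ∈ A) :
    ∑ z ∈ outerBoundary (zdGraph 2) A, poissonKernel A x z = 1 :=
  sum_poissonKernel (by norm_num : 0 < 2) A hx

/-- For `A ∈ 𝒜ⁿ`, every exit point `z ∈ ∂A` satisfies `|z| ≥ n` (it lies outside `A`).
[cite: KozdronLawler2005, §2.1] -/
theorem norm_ge_of_mem_outerBoundary {n : ℕ} (hA : IsClass n A) {z : Site 2}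
    (hz : z ∈ outerBoundary (zdGraph 2) A) : (n : ℝ) ≤ ‖Site.toComplex z‖ :=
  hA.2.2.2.1 z (mem_outerBoundary_iff.1 hz).1

end PlanarSet

end KozdronLawler

end Literature.Probability.LatticeModels

end
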